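import Literature.NumberTheory.EllipticCurves.HeckeOperatorsAdjointProofs
import Literature.NumberTheory.EllipticCurves.Newforms
import HarnessLib

/-!
# The algebraic new subspace is Petersson-orthogonal to the old subspace:
# `S_k(Γ₀(N))^{new} ⊆ (S_k(Γ₀(N))^{old})^⊥` (proofs for `Newforms.lean`)

D-0014 keeps `Literature/` sorry-free by stating cited results as named facts `def X : Prop`.
`Newforms.lean` defines the new subspace `newSubspace0 N k` *algebraically*, as the joint kernel
of the adjoint degeneracy maps `adjDegeneracyMap0 N M d k = [Γ₀(N) diag(1, d) Γ₀(M)]`, and the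
old subspace `oldSubspace0 N k` as the span of the images of the degeneracy maps
`degeneracyMap0 M N d k = [Γ₀(M) diag(d, 1) Γ₀(N)]` (`M` a proper divisor of `N`, `M d ∣ N`), and
records as the named fact `newSubspace0_eq_orthogonal N k` (Atkin–Lehner 1970, Thm. 5; Li 1975,
Thm. 3) that the former is the Petersson orthogonal complement of the latter. This sibling file
**proves the inclusion `newSubspace0 N k ⊆ (oldSubspace0 N k)^⊥`** — the half consumed by the
Atkin–Lehner `w_N`-argument (`CuspFormLFunctionAtkinLehnerProofs`) — for every level and weight:

* `cuspHeckeCorrespondence_adjoint` — **adjointness of double coset correspondences between two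
  levels**: for arithmetic `Γ, Γ' ≤ SL₂(ℤ)` (images in `GL(2, ℝ)`), `α ∈ GL₂⁺(ℚ)` and
  `α' = det(α) α⁻¹`, `⟨[Γ α Γ'] f, g⟩_{Γ'} = ⟨f, [Γ' α' Γ] g⟩_Γ` for `f ∈ S_k(Γ)`, `g ∈ S_k(Γ')`.
  This is Diamond–Shurman Prop. 5.5.2(b) (PDF p. 206, book p. 186: `[ΓαΓ]_k^* = [Γα'Γ]_k`) with
  two levels instead of one, by the very same chain as the tree's `cuspHeckeOperator_adjoint`:
  `⟨[ΓαΓ']f, g⟩_{Γ'} = ⟨f∣α, g⟩_{α⁻¹Γα ∩ Γ'}` (the trace is adjoint to restriction,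
  `peterssonProduct_trace_left`) `= conj ⟨g, f∣α⟩ = conj ⟨g∣α', f⟩_{α'⁻¹Γ'α' ∩ Γ}`
  (Prop. 5.5.2(a), `peterssonProduct_translate_adjoint`) `= conj ⟨[Γ'α'Γ]g, f⟩_Γ = ⟨f, [Γ'α'Γ]g⟩_Γ`.
* `peterssonProduct_degeneracyMap0_adjDegeneracyMap0` — the degeneracy map
  `[Γ₀(M) diag(d,1) Γ₀(N)]` and `adjDegeneracyMap0 N M d k = [Γ₀(N) diag(1,d) Γ₀(M)]` are
  Petersson-adjoint for *all* `(M, N, d)` (`diag(1, d) = det · diag(d, 1)⁻¹`; Li 1975, §2, Lemma 5,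
  the design of `adjDegeneracyMap0`). The sibling `NewformsOldNewProofs` (landed concurrently)
  proves the case `M d ∣ N` as `peterssonProduct_degeneracyMap0_left` through the one-term
  description of the degeneracy map, and from it `old ∩ new = 0`
  (`disjoint_oldSubspace0_newSubspace0_holds`); the present file is independent of it.
* additivity of the Petersson product in the second variable (private here; Diamond–Shurman §5.4).
* `peterssonProduct_eq_zero_of_mem_newSubspace0_of_mem_oldSubspace0`,
  `newSubspace0_le_orthogonal_oldSubspace0` — **`new ⊥ old`**: for `f ∈ newSubspace0 N k` and
  `g ∈ oldSubspace0 N k`, `⟨f, g⟩ = 0` (for `g = [Γ₀(M) diag(d,1) Γ₀(N)] g'`,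
  `⟨f, g⟩ = conj ⟨g, f⟩ = conj ⟨g', adj f⟩ = 0`, and orthogonality passes to the span).

## References

* F. Diamond, J. Shurman, *A first course in modular forms*, GTM 228, Springer 2005, §5.4
  (Def. 5.4.1), Prop. 5.5.2 (p. 186), Def. 5.6.1.
* W.-C. W. Li, *Newforms and functional equations*, Math. Ann. 212 (1975), 285–315, §2, Lemma 5,
  Thm. 3.
* A. O. L. Atkin, J. Lehner, *Hecke operators on `Γ₀(m)`*, Math. Ann. 185 (1970), 134–160, Thm. 5.
-/

noncomputable section

open scoped MatrixGroups ModularForm ComplexConjugate Modular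

open ConjAct Pointwise UpperHalfPlane MeasureTheory

namespace Literature.NumberTheory.EllipticCurves.ModularForms

/-! ### Additivity of the Petersson product -/

section Linearity

variable (Λ : Subgroup (GL (Fin 2) ℝ)) [Λ.IsArithmetic] [Λ.HasDetOne] (k : ℤ)

/-- The Petersson product is additive in the second (linear) variable (Diamond–Shurman §5.4, after
Def. 5.4.1: the product is linear in one variable and conjugate linear in the other); each coset
summand of the integrand is integrable on the fundamental domain
(`integrableOn_petersson_comp_smul_fd`). (Private: the sibling `NewformsOldNewProofs` exports the
first-variable versions `peterssonProduct_add_left`, `peterssonProduct_zero_left/right`.)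
[cite: DiamondShurman2005, §5.4 (after Def. 5.4.1)] -/
private theorem peterssonProduct_add_right_aux (F G₁ G₂ : CuspForm Λ k) :
    peterssonProduct Λ k F (G₁ + G₂) = peterssonProduct Λ k F G₁ + peterssonProduct Λ k F G₂ := by
  letI := Fintype.ofFinite (𝒮ℒ ⧸ Λ.subgroupOf 𝒮ℒ)
  have hint : ∀ G : CuspForm Λ k, IntegrableOn (fun τ ↦ ∑ q : 𝒮ℒ ⧸ Λ.subgroupOf 𝒮ℒ,
      petersson k ⇑F ⇑G (((q.out : 𝒮ℒ) : GL (Fin 2) ℝ)⁻¹ • τ)) 𝒟 := fun G ↦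
    integrable_finsetSum _ fun q _ ↦ integrableOn_petersson_comp_smul_fd k F G (q.out).2
  rw [peterssonProduct_eq_setIntegral, peterssonProduct_eq_setIntegral,
    peterssonProduct_eq_setIntegral, ← integral_add (hint G₁) (hint G₂)]
  refine integral_congr_ae (Filter.Eventually.of_forall fun τ ↦ ?_)
  simp only [← Finset.sum_add_distrib]
  refine Finset.sum_congr rfl fun q _ ↦ ?_
  simp only [petersson, CuspForm.coe_add, Pi.add_apply]
  ring

/-- `⟨F, 0⟩ = 0`. [folklore] -/
private theorem peterssonProduct_zero_right_aux (F : CuspForm Λ k) : peterssonProduct Λ k F 0 = 0 := by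
  letI := Fintype.ofFinite (𝒮ℒ ⧸ Λ.subgroupOf 𝒮ℒ)
  rw [peterssonProduct_eq_setIntegral]
  simp [petersson]

end Linearity

/-! ### Adjointness of double coset correspondences between two levels -/

section Adjoint

variable (α α' : GL(2, ℚ)⁺)
  (hα' : ((α' : GL (Fin 2) ℚ) : Matrix (Fin 2) (Fin 2) ℚ) =
    ((α : GL (Fin 2) ℚ) : Matrix (Fin 2) (Fin 2) ℚ).adjugate)

include hα' in
/-- `α⁻¹ (α'⁻¹ Γ' α' ∩ Γ) α = α⁻¹ Γ α ∩ Γ'`: the auxiliary levels of the two sides of the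
adjointness relation are conjugate (two-level version of the tree's `conj_level_adjugate`;
`α' α = det(α) · 1` is central). [folklore] -/
lemma conj_level_adjugate₂ (Γ Γ' : Subgroup (GL (Fin 2) ℝ)) :
    toConjAct (glCast (α : GL (Fin 2) ℚ))⁻¹ •
        (toConjAct (glCast (α' : GL (Fin 2) ℚ))⁻¹ • Γ' ⊓ Γ) =
      toConjAct (glCast (α : GL (Fin 2) ℚ))⁻¹ • Γ ⊓ Γ' := by
  rw [Subgroup.smul_inf, ← mul_smul, ← map_mul, ← mul_inv_rev,
    conj_glCast_mul_glCast_smul_of_eq_adjugate α α' hα', inf_comm]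

/-- **Adjoints of double coset correspondences between two levels** (Diamond–Shurman Prop. 5.5.2(b),
p. 186, "`⟨f[ΓαΓ]_k, g⟩ = ⟨f, g[Γα'Γ]_k⟩`", in the two-level form `[Γ α Γ']_k^* = [Γ' α' Γ]_k`
needed for the degeneracy maps; Li 1975, §2, Lemma 5): for arithmetic `Γ, Γ' ≤ 𝒮ℒ`,
`α ∈ GL₂⁺(ℚ)` and `α'` with matrix `det(α) α⁻¹`, and `f ∈ S_k(Γ)`, `g ∈ S_k(Γ')`,
`P_{Γ'}([Γ α Γ'] f, g) = P_Γ(f, [Γ' α' Γ] g)` for the tree's `peterssonProduct` (antilinear in the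
first variable, no volume factor). Proof: the chain
`P_{Γ'}([ΓαΓ']f, g) = P_{Γ₃}(f∣α, g) = conj P_{Γ₃}(g, f∣α) = conj P_{Γ₃'}(g∣α', f)
= conj P_Γ([Γ'α'Γ]g, f) = P_Γ(f, [Γ'α'Γ]g)` with `Γ₃ = α⁻¹Γα ∩ Γ'`, `Γ₃' = α'⁻¹Γ'α' ∩ Γ = α Γ₃ α⁻¹`
(`peterssonProduct_trace_left`, `peterssonProduct_conj_symm_holds`,
`peterssonProduct_translate_adjoint`), exactly as in `cuspHeckeOperator_adjoint` (the case
`Γ' = Γ`). [cite: DiamondShurman2005, Prop. 5.5.2(b)] -/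
theorem cuspHeckeCorrespondence_adjoint (Γ Γ' : Subgroup (GL (Fin 2) ℝ)) [Γ.IsArithmetic]
    [Γ.HasDetOne] [Γ'.IsArithmetic] [Γ'.HasDetOne] (hΓ : Γ ≤ 𝒮ℒ) (hΓ' : Γ' ≤ 𝒮ℒ) (k : ℤ)
    (hα' : ((α' : GL (Fin 2) ℚ) : Matrix (Fin 2) (Fin 2) ℚ) =
      ((α : GL (Fin 2) ℚ) : Matrix (Fin 2) (Fin 2) ℚ).adjugate)
    (f : CuspForm Γ k) (g : CuspForm Γ' k) :
    peterssonProduct Γ' k (cuspHeckeCorrespondenceₗ Γ Γ' k α f) g =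
      peterssonProduct Γ k f (cuspHeckeCorrespondenceₗ Γ' Γ k α' g) := by
  -- the auxiliary levels `Γ₃ = α⁻¹Γα ∩ Γ'`, `Γ₃' = α'⁻¹Γ'α' ∩ Γ` and the four forms on them
  obtain ⟨F₁, hF₁⟩ := exists_cuspForm_coe_eq_of_le
    (Γ' := toConjAct (glCast (α : GL (Fin 2) ℚ))⁻¹ • Γ ⊓ Γ') inf_le_left
    (CuspForm.translate f (glCast (α : GL (Fin 2) ℚ)))
  obtain ⟨G, hG⟩ := exists_cuspForm_coe_eq_of_le
    (Γ' := toConjAct (glCast (α : GL (Fin 2) ℚ))⁻¹ • Γ ⊓ Γ') inf_le_right g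
  obtain ⟨G₁, hG₁⟩ := exists_cuspForm_coe_eq_of_le
    (Γ' := toConjAct (glCast (α' : GL (Fin 2) ℚ))⁻¹ • Γ' ⊓ Γ) inf_le_left
    (CuspForm.translate g (glCast (α' : GL (Fin 2) ℚ)))
  obtain ⟨F, hF⟩ := exists_cuspForm_coe_eq_of_le
    (Γ' := toConjAct (glCast (α' : GL (Fin 2) ℚ))⁻¹ • Γ' ⊓ Γ) inf_le_right f
  have step1 : peterssonProduct Γ' k (cuspHeckeCorrespondenceₗ Γ Γ' k α f) g =
      peterssonProduct _ k F₁ G :=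
    peterssonProduct_trace_left k hΓ' (CuspForm.translate f (glCast (α : GL (Fin 2) ℚ))) g F₁ G
      hF₁ hG
  have step3 : peterssonProduct _ k G F₁ = peterssonProduct _ k G₁ F :=
    peterssonProduct_translate_adjoint (toConjAct (glCast (α' : GL (Fin 2) ℚ))⁻¹ • Γ' ⊓ Γ)
      (inf_le_right.trans hΓ) k α α' hα' (toConjAct (glCast (α : GL (Fin 2) ℚ))⁻¹ • Γ ⊓ Γ')
      (conj_level_adjugate₂ α α' hα' Γ Γ').symm (inf_le_right.trans hΓ') F G F₁ G₁
      (by rw [hF₁, hF, coe_cuspForm_translate]) (by rw [hG₁, hG, coe_cuspForm_translate])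
  have step4 : peterssonProduct Γ k (cuspHeckeCorrespondenceₗ Γ' Γ k α' g) f =
      peterssonProduct _ k G₁ F :=
    peterssonProduct_trace_left k hΓ (CuspForm.translate g (glCast (α' : GL (Fin 2) ℚ))) f G₁ F
      hG₁ hF
  rw [step1, peterssonProduct_conj_symm_holds _ k G F₁, step3, ← step4,
    ← peterssonProduct_conj_symm_holds]

end Adjoint

/-! ### The degeneracy maps of `Newforms.lean` are Petersson-adjoint; `new ⊥ old` -/

section Degeneracy

open CongruenceSubgroup

/-- **The degeneracy map and the adjoint degeneracy map are Petersson-adjoint**: for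
`g ∈ S_k(Γ₀(M))`, `h ∈ S_k(Γ₀(N))` and `d ≥ 1`,
`⟨[Γ₀(M) diag(d,1) Γ₀(N)] g, h⟩_{Γ₀(N)} = ⟨g, [Γ₀(N) diag(1,d) Γ₀(M)] h⟩_{Γ₀(M)}`, i.e.
`⟨degeneracyMap0 M N d k g, h⟩ = ⟨g, adjDegeneracyMap0 N M d k h⟩` (`diag(1, d) = det · diag(d, 1)⁻¹`;
Li 1975, §2, Lemma 5 — the defining design of `adjDegeneracyMap0`; Diamond–Shurman Prop. 5.5.2).
No divisibility hypothesis on `(M, N, d)` is needed for this formal adjointness.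
[cite: DiamondShurman2005, Prop. 5.5.2(b)] -/
theorem peterssonProduct_degeneracyMap0_adjDegeneracyMap0 (M N d : ℕ) [NeZero M] [NeZero N]
    [NeZero d] (k : ℤ)
    (g : CuspForm (Gamma0 M) k) (h : CuspForm (Gamma0 N) k) :
    peterssonProduct (Gamma0 N) k (degeneracyMap0 M N d k g) h =
      peterssonProduct (Gamma0 M) k g (adjDegeneracyMap0 N M d k h) :=
  cuspHeckeCorrespondence_adjoint _ _ (Gamma0 M) (Gamma0 N) (Subgroup.map_le_range _ _)
    (Subgroup.map_le_range _ _) k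
    (coe_coe_diagGL_eq_adjugate d 1 (Nat.cast_pos.mpr (NeZero.pos d)) one_pos) g h

variable (N : ℕ) [NeZero N] (k : ℤ)

/-- **`new ⊥ old`**: a form in the algebraic new subspace `newSubspace0 N k` (the joint kernel of
the adjoint degeneracy maps) is Petersson-orthogonal to every old form: for
`g = [Γ₀(M) diag(d,1) Γ₀(N)] g'` one has `⟨f, g⟩ = conj ⟨g, f⟩ = conj ⟨g', adj_d f⟩ = 0`
(`peterssonProduct_degeneracyMap0_adjDegeneracyMap0`), and orthogonality passes to sums
(additivity of the Petersson product). This is the inclusion `S_k(Γ₀(N))^{new} ⊆ (S_k(Γ₀(N))^{old})^⊥`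
of the named fact `newSubspace0_eq_orthogonal` (Atkin–Lehner 1970, Thm. 5; Li 1975, Thm. 3;
Diamond–Shurman Def. 5.6.1). [cite: AtkinLehner1970, Thm. 5] [cite: DiamondShurman2005, Prop. 5.5.2(b)] -/
theorem peterssonProduct_eq_zero_of_mem_newSubspace0_of_mem_oldSubspace0
    {f g : CuspForm (Gamma0 N) k} (hf : f ∈ newSubspace0 N k) (hg : g ∈ oldSubspace0 N k) :
    peterssonProduct (Gamma0 N) k f g = 0 := by
  unfold oldSubspace0 at hg
  refine Submodule.iSup_induction _ (motive := fun g ↦ peterssonProduct (Gamma0 N) k f g = 0) hg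
    (fun Md _ hg' ↦ ?_) (Literature.NumberTheory.EllipticCurves.ModularForms.peterssonProduct_zero_right_aux _ k f) (fun g₁ g₂ h₁ h₂ ↦ ?_)
  · obtain ⟨g', rfl⟩ := LinearMap.mem_range.mp hg'
    have hker : adjDegeneracyMap0 N Md.1.1 Md.1.2 k f = 0 :=
      LinearMap.mem_ker.mp ((Submodule.mem_iInf _).mp hf Md)
    rw [peterssonProduct_conj_symm_holds, peterssonProduct_degeneracyMap0_adjDegeneracyMap0, hker,
      Literature.NumberTheory.EllipticCurves.ModularForms.peterssonProduct_zero_right_aux, map_zero]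
  · rw [Literature.NumberTheory.EllipticCurves.ModularForms.peterssonProduct_add_right_aux, h₁, h₂, add_zero]

/-- `S_k(Γ₀(N))^{new} ⊆ (S_k(Γ₀(N))^{old})^⊥`, as an inclusion of sets in the shape of the named
fact `newSubspace0_eq_orthogonal N k` of `Newforms.lean` (whose other inclusion is Atkin–Lehner
1970, Thm. 5 / Li 1975, Thm. 3). [cite: AtkinLehner1970, Thm. 5] -/
theorem newSubspace0_le_orthogonal_oldSubspace0 :
    (newSubspace0 N k : Set (CuspForm (Gamma0 N) k)) ⊆
      {f | ∀ g ∈ oldSubspace0 N k, peterssonProduct (Gamma0 N) k f g = 0} :=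
  fun _ hf _ hg ↦ peterssonProduct_eq_zero_of_mem_newSubspace0_of_mem_oldSubspace0 N k hf hg

end Degeneracy

end Literature.NumberTheory.EllipticCurves.ModularForms

end
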